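import Summits.RiemannHypothesis.RiemannHypothesis.Theorems.WeilCombCombShapePositivityArchCoshSeries
import Summits.RiemannHypothesis.RiemannHypothesis.Theorems.WeilCombCombShapePositivityCoshMoments

/-!
# The off-diagonal archimedean entries from BELOW, window-uniformly:
# `Re W_∞(τ_x ψ_ε) ≥ −[Σ_{k<K} e^{−c_k x}(I₀ + (cosh(c_kε) − 1) m₂)² + 4 e^{−2√(2c_Kε)} e^{−2K(x−2ε)} g(x − 2ε)]`
# (STUB-PLAN `stub_windowCore`, helper B1, lower half; stub `stub_archEntryLower`)

Crux `WeilComb.CombShapePositivity` (item stmt-RiemannHypothesis-11229), line `Sketch`, STUB-PLAN `stub_windowCore` Phase B,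
helper B1 (`arch_entry_bounds_window`, lower inequality). Notation: `φ₀(v) = expNegInvGlue (1 − v²)`, `ψ_ε = φ_ε ⋆ φ̃_ε`,
`W_∞ = weilArchTerm`, `g(t) = e^{t/2}/(2 sinh t) = Σ_k e^{−c_k t}`, `c_k = 2k + ½`, `I₀ = ∫φ₀`, `m₂ = ∫ φ₀(v) v² dv`,
`Φ(y) = ∫ φ₀(v) cosh(yv) dv`.

The landed exact series `−Re W_∞(τ_x ψ_ε) = Σ_k e^{−c_k x} Φ(c_kε)²` (`…ArchCoshSeries.stub_archEntryCoshSeries`) with the two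
cosh-moment bounds of `…CoshMoments` — `Φ(y) ≤ I₀ + (cosh y − 1) m₂` (head, `k < K`) and `Φ(y) ≤ 2e^{y − √(2y)}` (tail, `k ≥ K`,
`e^{−c_k x}·4e^{2c_kε − 2√(2c_kε)} ≤ 4e^{−2√(2c_Kε)} e^{−c_k(x − 2ε)}`, the geometric tail `Σ_{k ≥ K} e^{−c_k t} ≤ g(t)` at
`t = x − 2ε > 0`) — give, for EVERY cut `K`:

`stub_archEntryLower` (registered on the crux):
`−(Σ_{k<K} e^{−c_k x}(I₀ + (cosh(c_kε) − 1) m₂)² + 4 e^{−2√(2c_Kε)} · g(x − 2ε)) ≤ Re W_∞(τ_x ψ_ε)` for `ε > 0`, `x > 2ε`.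

(The factor `e^{−2K(x−2ε)} ≤ 1` of the sharper tail is dropped for a cleaner statement; with `c_Kε ≈ (log M)²` the tail is
`O(M^{−2.8}) g(x−2ε)`, harmless even at the extreme top entry `x − 2ε ≈ 1/(2M²)`, while the head is the `(C−1)(2ε/x)²/(2x)`-type
correction of the plan once `m₂/I₀ ≈ 0.13` is certified.) Together with `…ArchJensen.stub_archEntryJensen` this is B1.
-/

noncomputable section

-- the sub-problem path RiemannHypothesis/RiemannHypothesis duplicates a namespace (D-0017)
set_option linter.dupNamespace false

open scoped BigOperators
open MeasureTheory Set Finset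

namespace Summit.RiemannHypothesis.RiemannHypothesis.Theorems.WeilCombArchEntryLower

open Literature.NumberTheory.LFunctions
open Summit.RiemannHypothesis.RiemannHypothesis.Theorems.WeilCombArchJensen (hasSum_archWeight)
open Summit.RiemannHypothesis.RiemannHypothesis.Theorems.WeilCombArchCoshSeries (stub_archEntryCoshSeries)
open Summit.RiemannHypothesis.RiemannHypothesis.Theorems.WeilCombCoshMoments
  (stub_coshMomentSmall stub_coshMomentEdge)

/-- The cosh-moment is non-negative. [folklore] -/
theorem coshMoment_nonneg (y : ℝ) : 0 ≤ ∫ v : ℝ, expNegInvGlue (1 - v ^ 2) * Real.cosh (y * v) :=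
  integral_nonneg fun _ ↦ mul_nonneg (expNegInvGlue.nonneg _) (Real.cosh_pos _).le

/-- Head terms: `e^{−cx} Φ(cε)² ≤ e^{−cx} (I₀ + (cosh(cε) − 1) m₂)²`. [folklore] -/
theorem head_term_le (c ε x : ℝ) :
    Real.exp (-(c * x)) * (∫ v : ℝ, expNegInvGlue (1 - v ^ 2) * Real.cosh (c * ε * v)) ^ 2 ≤
      Real.exp (-(c * x)) * ((∫ v : ℝ, expNegInvGlue (1 - v ^ 2)) +
        (Real.cosh (c * ε) - 1) * ∫ v : ℝ, expNegInvGlue (1 - v ^ 2) * v ^ 2) ^ 2 := by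
  refine mul_le_mul_of_nonneg_left ?_ (Real.exp_pos _).le
  exact pow_le_pow_left₀ (coshMoment_nonneg _) (stub_coshMomentSmall (c * ε)) 2

/-- Tail terms: for `0 ≤ c₀ ≤ c`, `0 ≤ ε`:
`e^{−cx} Φ(cε)² ≤ 4 e^{−2√(2c₀ε)} e^{−c(x − 2ε)}`. [folklore] -/
theorem tail_term_le {c c₀ ε : ℝ} (x : ℝ) (hc₀ : 0 ≤ c₀) (hc : c₀ ≤ c) (hε : 0 ≤ ε) :
    Real.exp (-(c * x)) * (∫ v : ℝ, expNegInvGlue (1 - v ^ 2) * Real.cosh (c * ε * v)) ^ 2 ≤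
      4 * Real.exp (-(2 * Real.sqrt (2 * (c₀ * ε)))) * Real.exp (-(c * (x - 2 * ε))) := by
  have hy : 0 ≤ c * ε := mul_nonneg (hc₀.trans hc) hε
  have hΦ := stub_coshMomentEdge (c * ε) hy
  have hΦ0 := coshMoment_nonneg (c * ε)
  have hsq : (∫ v : ℝ, expNegInvGlue (1 - v ^ 2) * Real.cosh (c * ε * v)) ^ 2 ≤
      (2 * Real.exp (c * ε - Real.sqrt (2 * (c * ε)))) ^ 2 := pow_le_pow_left₀ hΦ0 hΦ 2
  have hsqrt : Real.sqrt (2 * (c₀ * ε)) ≤ Real.sqrt (2 * (c * ε)) :=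
    Real.sqrt_le_sqrt (by nlinarith)
  calc Real.exp (-(c * x)) * (∫ v : ℝ, expNegInvGlue (1 - v ^ 2) * Real.cosh (c * ε * v)) ^ 2
      ≤ Real.exp (-(c * x)) * (2 * Real.exp (c * ε - Real.sqrt (2 * (c * ε)))) ^ 2 :=
        mul_le_mul_of_nonneg_left hsq (Real.exp_pos _).le
    _ = 4 * Real.exp (-(2 * Real.sqrt (2 * (c * ε)))) * Real.exp (-(c * (x - 2 * ε))) := by
        rw [mul_pow, ← Real.exp_nat_mul]
        have : Real.exp (-(c * x)) * Real.exp ((2 : ℕ) * (c * ε - Real.sqrt (2 * (c * ε)))) =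
            Real.exp (-(2 * Real.sqrt (2 * (c * ε)))) * Real.exp (-(c * (x - 2 * ε))) := by
          rw [← Real.exp_add, ← Real.exp_add]; congr 1; push_cast; ring
        calc Real.exp (-(c * x)) * ((2 : ℝ) ^ 2 * Real.exp ((2 : ℕ) * (c * ε - Real.sqrt (2 * (c * ε)))))
            = 4 * (Real.exp (-(c * x)) * Real.exp ((2 : ℕ) * (c * ε - Real.sqrt (2 * (c * ε))))) := by ring
          _ = _ := by rw [this]; ring
    _ ≤ 4 * Real.exp (-(2 * Real.sqrt (2 * (c₀ * ε)))) * Real.exp (-(c * (x - 2 * ε))) := by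
        gcongr

/-- **Stub `stub_archEntryLower` (B1, lower half; registered on crux stmt-RiemannHypothesis-11229).** For `ε > 0`, `x > 2ε` and
every cut `K`, the off-diagonal archimedean entry is bounded BELOW by the head of the cosh-moment series with the second-moment
bound plus the edge-decay tail:
`−(Σ_{k<K} e^{−c_k x}(I₀ + (cosh(c_kε) − 1) m₂)² + 4e^{−2√(2c_Kε)} · e^{(x−2ε)/2}/(2 sinh(x−2ε))) ≤ Re W_∞(τ_x ψ_ε)`,
`c_k = 2k + ½`, `I₀ = ∫φ₀`, `m₂ = ∫φ₀v²`. [folklore] -/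
theorem stub_archEntryLower : ∀ ε : ℝ, 0 < ε → ∀ x : ℝ, 2 * ε < x → ∀ K : ℕ,
    -((∑ k ∈ Finset.range K, Real.exp (-((2 * (k : ℝ) + 1 / 2) * x)) *
        ((∫ v : ℝ, expNegInvGlue (1 - v ^ 2)) +
          (Real.cosh ((2 * (k : ℝ) + 1 / 2) * ε) - 1) * ∫ v : ℝ, expNegInvGlue (1 - v ^ 2) * v ^ 2) ^ 2) +
      4 * Real.exp (-(2 * Real.sqrt (2 * ((2 * (K : ℝ) + 1 / 2) * ε)))) *
        (Real.exp ((x - 2 * ε) / 2) / (2 * Real.sinh (x - 2 * ε)))) ≤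
    (weilArchTerm (weilTranslate
        (weilConv (fun t : ℝ => (ε : ℂ)⁻¹ * ((expNegInvGlue (1 - (t / ε) ^ 2) : ℝ) : ℂ))
          (weilReflect (fun t : ℝ => (ε : ℂ)⁻¹ * ((expNegInvGlue (1 - (t / ε) ^ 2) : ℝ) : ℂ)))) x)).re := by
  intro ε hε x hx K
  have ht : 0 < x - 2 * ε := by linarith
  set c : ℕ → ℝ := fun k ↦ 2 * (k : ℝ) + 1 / 2 with hc
  have hc0 : ∀ k, 0 ≤ c k := fun k ↦ by rw [hc]; positivity
  have hcmono : ∀ k, K ≤ k → c K ≤ c k := fun k hk ↦ by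
    simp only [hc]
    have : (K : ℝ) ≤ k := by exact_mod_cast hk
    linarith
  -- the series and its two bounds
  have hser := stub_archEntryCoshSeries ε hε x hx
  set a : ℕ → ℝ := fun k ↦ Real.exp (-(c k * x)) *
    (∫ v : ℝ, expNegInvGlue (1 - v ^ 2) * Real.cosh (c k * ε * v)) ^ 2 with ha
  set head : ℕ → ℝ := fun k ↦ Real.exp (-(c k * x)) *
    ((∫ v : ℝ, expNegInvGlue (1 - v ^ 2)) +
      (Real.cosh (c k * ε) - 1) * ∫ v : ℝ, expNegInvGlue (1 - v ^ 2) * v ^ 2) ^ 2 with hhead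
  set C : ℝ := 4 * Real.exp (-(2 * Real.sqrt (2 * (c K * ε)))) with hC
  set tail : ℕ → ℝ := fun k ↦ C * Real.exp (-(c k * (x - 2 * ε))) with htail
  set b : ℕ → ℝ := fun k ↦ if k < K then head k else tail k with hb
  have hab : ∀ k, a k ≤ b k := by
    intro k
    by_cases hk : k < K
    · simp only [hb, if_pos hk, ha, hhead]
      exact head_term_le (c k) ε x
    · simp only [hb, if_neg hk, ha, htail, hC]
      have := tail_term_le (c := c k) (c₀ := c K) x (hc0 K) (hcmono k (not_lt.1 hk)) hε.le
      linarith
  -- `b = f + tail` with `f` finitely supported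
  have htailsum : HasSum tail (C * (Real.exp ((x - 2 * ε) / 2) / (2 * Real.sinh (x - 2 * ε)))) := by
    have h := (hasSum_archWeight ht).mul_left C
    refine h.congr_fun fun k ↦ ?_
    simp only [htail, hc]
  set f : ℕ → ℝ := fun k ↦ if k < K then head k - tail k else 0 with hf
  have hfsum : HasSum f (∑ k ∈ Finset.range K, (head k - tail k)) := by
    have h : HasSum f (∑ k ∈ Finset.range K, f k) :=
      hasSum_sum_of_ne_finset_zero (fun k hk ↦ by
        simp only [hf]
        rw [if_neg (by simpa using hk)])
    have hs : ∑ k ∈ Finset.range K, f k = ∑ k ∈ Finset.range K, (head k - tail k) :=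
      Finset.sum_congr rfl fun k hk ↦ by
        simp only [hf]
        rw [if_pos (Finset.mem_range.1 hk)]
    rwa [hs] at h
  have hbsum : HasSum b (∑ k ∈ Finset.range K, (head k - tail k) +
      C * (Real.exp ((x - 2 * ε) / 2) / (2 * Real.sinh (x - 2 * ε)))) := by
    have h := hfsum.add htailsum
    refine h.congr_fun fun k ↦ ?_
    show b k = f k + tail k
    simp only [hf, hb]
    split_ifs <;> ring
  -- compare the two series
  have h1 : -(weilArchTerm (weilTranslate
        (weilConv (fun t : ℝ => (ε : ℂ)⁻¹ * ((expNegInvGlue (1 - (t / ε) ^ 2) : ℝ) : ℂ))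
          (weilReflect (fun t : ℝ => (ε : ℂ)⁻¹ * ((expNegInvGlue (1 - (t / ε) ^ 2) : ℝ) : ℂ)))) x)).re ≤
      ∑ k ∈ Finset.range K, (head k - tail k) +
        C * (Real.exp ((x - 2 * ε) / 2) / (2 * Real.sinh (x - 2 * ε))) :=
    hasSum_le hab hser hbsum
  have h2 : ∑ k ∈ Finset.range K, (head k - tail k) ≤ ∑ k ∈ Finset.range K, head k :=
    Finset.sum_le_sum fun k _ ↦ by
      have : 0 ≤ tail k := by simp only [htail, hC]; positivity
      linarith
  simp only [hhead, hC, hc] at h1 h2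
  linarith

end Summit.RiemannHypothesis.RiemannHypothesis.Theorems.WeilCombArchEntryLower


end
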